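import Literature.Computability.Cryptography.HallgrenClassGroupSamplerCount
import Literature.Computability.Cryptography.HallgrenClassGroupDivisorSums
import Mathlib.Data.Finset.NatDivisors
import HarnessLib

/-!
# Reduced ideals of a real quadratic field as integer pairs: at most `τ(a)` reduced pairs `(a, ·)`,
# and the pairs lost to a divisor threshold

Topic `Literature/Computability/Cryptography`, companion of `HallgrenClassGroupSamplerCount.lean` (the
imaginary case: reduced FORMS with a given first coefficient, `Hallgren2005.card_reducedForms_fst_eq_le`)
for the REAL case. A reduced primitive ideal `[a, (b + √D)/2]` of the real quadratic field `K` of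
discriminant `D = d_K > 0` is recorded as the integer pair `(a, b)` with

  `0 < a`, `0 < b`, `b² < D`, `4a ∣ D − b²`, `D < (2a + b)²`, `2a ≤ b ∨ (2a − b)² < D`

(i.e. `|√D − 2a| < b < √D`, Jacobson–Williams 2009, Thm. 5.8 / (5.33); all comparisons squared, no new
definition is introduced — the six conditions are carried as a hypothesis on a finite set of pairs).
Everything here is PROVED (theorems only):

* `RealReducedPairs.fst_mul_self_lt`, `RealReducedPairs.partner` — a reduced pair has `a² < D`, and
  `(a, b) ↦ ((D − b²)/(4a), b)` (the conjugate ideal, `4ac = D − b²`) is an involution of the reduced pairs;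
* `RealReducedPairs.card_filter_fst_eq_le_card_divisors` — **at most `τ(a)` reduced pairs have first entry
  `a`**: `b ↦ (a, ω − (b + t)/2)` is an injection into the ideals of norm `a` (`Quadratic.absNorm_span_pair_eq`;
  two reduced `b` with the same `a` differ by less than `2a`, and the ideal determines `b (mod 2a)`,
  `Quadratic.intCast_mem_span_pair_iff`), and `#{𝔞 : N𝔞 = a} ≤ τ(a)`
  (`Hallgren2005.card_ideals_absNorm_eq_le_card_divisors`, any quadratic field);
* `RealReducedPairs.threshold_fst_mul_card_le` — `K' · #{(a,b) ∈ s : τ(a) > K'} ≤ ∑_{a ≤ ⌊√D⌋} τ(a)²`;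
* `RealReducedPairs.threshold_mul_card_le` — **the pairs lost to a divisor threshold**:
  `K' · #{(a,b) ∈ s : τ((D − b²)/4) > K'²} ≤ 2 ∑_{a ≤ ⌊√D⌋} τ(a)²` (`τ(ac) ≤ τ(a)τ(c)` and the involution),
  hence `≤ 2√D (1 + log D)³` (`RealReducedPairs.threshold_mul_card_le_sqrt_mul_log`, with
  `Hallgren2005.sum_card_divisors_sq_le`);
* `RealReducedPairs.exists_finset` — the reduced pairs of `D` form a finite set.

These are the counting inputs of the reduced-ideal sampler for torsion witnesses in real quadratic class
groups (draw `b`, factor `(D − b²)/4`, draw a divisor `a`): the pairs whose `(D − b²)/4` has more than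
polylogarithmically many divisors are negligible.

## References

* M. J. Jacobson Jr., H. C. Williams, *Solving the Pell Equation*, CMS Books in Mathematics, Springer (2009),
  §5.3, Thm. 5.8 and (5.33) (reduced ideals `[a, (b + √D)/2]` of real quadratic orders) [JacobsonWilliams2008].
* H. Davenport, *Multiplicative Number Theory*, GTM 74, Ch. 6 (ideals of norm `n`) [DavenportMNT1980].
* D. A. Cox, *Primes of the form x² + ny²*, 2nd ed. (2013), Thm. 7.7 (`N[a, (−b+√D)/2] = a`) [Cox2013].
-/

noncomputable section

open scoped nonZeroDivisors
open Module NumberField Finset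
open Literature.NumberTheory.QuadraticFields Literature.NumberTheory.QuadraticFields.Quadratic
open Literature.NumberTheory.EllipticCurves

namespace Literature.Computability.Cryptography

namespace RealReducedPairs

/-! ### Integer arithmetic of reduced pairs -/

/-- A reduced pair `(a, b)` of `D` has `a² < D` (so `1 ≤ a ≤ ⌊√D⌋`). [cite: JacobsonWilliams2008, Thm. 5.8] -/
theorem fst_mul_self_lt {D a b : ℕ} (hb : b ^ 2 < D) (hred : 2 * a ≤ b ∨ (2 * a - b) ^ 2 < D) : a * a < D := by
  rcases hred with h | h
  · nlinarith
  · by_contra hD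
    push Not at hD
    have hba : b < a := by nlinarith
    have h2 : a ≤ 2 * a - b := by omega
    have h3 : a * a ≤ (2 * a - b) ^ 2 := by nlinarith
    omega

/-- A reduced pair `(a, b)` of `D` has `1 ≤ a ≤ ⌊√D⌋`. [cite: JacobsonWilliams2008, Thm. 5.8] -/
theorem fst_mem_Icc {D a b : ℕ} (ha : 0 < a) (hb : b ^ 2 < D) (hred : 2 * a ≤ b ∨ (2 * a - b) ^ 2 < D) :
    a ∈ Icc 1 (Nat.sqrt D) := by
  rw [mem_Icc, Nat.le_sqrt]
  exact ⟨ha, (fst_mul_self_lt hb hred).le⟩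

/-- **The conjugate of a reduced pair is reduced**: with `c = (D − b²)/(4a)` (so `4ac = D − b²`), the pair
`(c, b)` is again reduced, and `(D − b²)/(4c) = a` — `(a, b) ↦ (c, b)` is an involution of the reduced pairs
of `D` (the ideal `[a, (b+√D)/2]` and its conjugate-inverse partner `[c, (b+√D)/2]`; `|√D − 2c| < b` iff
`|√D − 2a| < b`). [cite: JacobsonWilliams2008, §5.3] -/
theorem partner {D a b : ℕ} (ha : 0 < a) (hb0 : 0 < b) (hb : b ^ 2 < D) (hdvd : 4 * a ∣ D - b ^ 2)
    (hlt : D < (2 * a + b) ^ 2) (hred : 2 * a ≤ b ∨ (2 * a - b) ^ 2 < D) :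
    (0 < (D - b ^ 2) / (4 * a) ∧ 0 < b ∧ b ^ 2 < D ∧ 4 * ((D - b ^ 2) / (4 * a)) ∣ D - b ^ 2 ∧
      D < (2 * ((D - b ^ 2) / (4 * a)) + b) ^ 2 ∧
      (2 * ((D - b ^ 2) / (4 * a)) ≤ b ∨ (2 * ((D - b ^ 2) / (4 * a)) - b) ^ 2 < D)) ∧
    (D - b ^ 2) / (4 * ((D - b ^ 2) / (4 * a))) = a := by
  obtain ⟨c, hc⟩ := hdvd
  have hc4 : (D - b ^ 2) / (4 * a) = c := by
    rw [hc, Nat.mul_div_cancel_left c (by omega)]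
  rw [hc4]
  have hE : D = b ^ 2 + 4 * a * c := by omega
  have hc0 : 0 < c := by
    rcases Nat.eq_zero_or_pos c with rfl | h
    · omega
    · exact h
  -- `a < b + c` from `(2a − b)² < D`, and `c < a + b` from `D < (2a + b)²`
  have hA : a < b + c := by
    by_cases h2 : 2 * a ≤ b
    · omega
    · push Not at h2
      have h : (2 * a - b) ^ 2 < D := hred.resolve_left (by omega)
      zify [h2.le] at h
      zify at hE
      nlinarith
  have hB : c < a + b := by nlinarith
  refine ⟨⟨hc0, hb0, hb, ⟨a, by rw [hc]; ring⟩, by nlinarith, ?_⟩, ?_⟩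
  · by_cases h2 : 2 * c ≤ b
    · exact Or.inl h2
    · right
      push Not at h2
      zify [h2.le]
      zify at hB hA hE
      nlinarith
  · rw [hc, show 4 * a * c = (4 * c) * a by ring, Nat.mul_div_cancel_left a (by omega)]

/-- For a reduced pair, `(D − b²)/4 = a · ((D − b²)/(4a))`. [folklore] -/
theorem quarter_eq_mul {D a b : ℕ} (ha : 0 < a) (hdvd : 4 * a ∣ D - b ^ 2) :
    (D - b ^ 2) / 4 = a * ((D - b ^ 2) / (4 * a)) := by
  obtain ⟨c, hc⟩ := hdvd
  rw [hc, show 4 * a * c = 4 * (a * c) by ring, Nat.mul_div_cancel_left _ (by norm_num),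
    show 4 * (a * c) = (4 * a) * c by ring, Nat.mul_div_cancel_left _ (by omega)]

/-! ### At most `τ(a)` reduced pairs with first entry `a` -/

variable {K : Type*} [Field K] [NumberField K]

/-- **At most `#{𝔞 : N𝔞 = a}` reduced pairs of `d_K` have first entry `a`** (`K` real quadratic): with an
integral basis `(1, ω)`, `ω² = m + tω`, `d_K = t² + 4m`, the pair `(a, b)` goes to the ideal `(a, ω − k)`,
`2k = b + t`, of norm `a` (`absNorm_span_pair_eq` with `a · (−c) = k² − tk − m`, `4ac = D − b²`); the ideal
determines `k (mod a)` (`intCast_mem_span_pair_iff`), i.e. `b (mod 2a)`, and two reduced `b, b'` with the same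
`a` satisfy `b' < 2a + b` (`b'² < D < (2a + b)²`), so the map is injective. [cite: Cox2013, Thm. 7.7] -/
theorem card_filter_fst_eq_le_card_ideals (h2 : finrank ℚ K = 2) (hpos : 0 < NumberField.discr K) {a : ℕ}
    (ha : 0 < a) (s : Finset (ℕ × ℕ))
    (hs : ∀ ab ∈ s, 0 < ab.1 ∧ 0 < ab.2 ∧ ab.2 ^ 2 < (NumberField.discr K).toNat ∧
      4 * ab.1 ∣ (NumberField.discr K).toNat - ab.2 ^ 2 ∧ (NumberField.discr K).toNat < (2 * ab.1 + ab.2) ^ 2 ∧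
      (2 * ab.1 ≤ ab.2 ∨ (2 * ab.1 - ab.2) ^ 2 < (NumberField.discr K).toNat)) :
    (s.filter fun ab => ab.1 = a).card ≤ Nat.card {I : Ideal (𝓞 K) // Ideal.absNorm I = a} := by
  classical
  obtain ⟨bs, hbs⟩ := exists_basis_zero_eq_one (K := K) h2
  set m : ℤ := bs.repr (bs 1 * bs 1) 0 with hm
  set t : ℤ := bs.repr (bs 1 * bs 1) 1 with ht
  have hω : bs 1 * bs 1 = (m : 𝓞 K) + (t : 𝓞 K) * bs 1 := basis_one_mul_self_eq bs hbs
  have hDK : NumberField.discr K = t ^ 2 + 4 * m := discr_eq_sq_add_four_mul bs hbs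
  set D : ℕ := (NumberField.discr K).toNat with hD
  have hDZ : (D : ℤ) = NumberField.discr K := Int.toNat_of_nonneg hpos.le
  haveI : Finite {I : Ideal (𝓞 K) // Ideal.absNorm I = a} := (Ideal.finite_setOf_absNorm_eq a).to_subtype
  -- the discriminant identity of a pair: `b² − 4·a·(−c) = t² + 4m`
  have hdisc : ∀ ab ∈ s.filter (fun ab => ab.1 = a),
      (ab.2 : ℤ) ^ 2 - 4 * (a : ℤ) * (-(((D - ab.2 ^ 2) / (4 * a) : ℕ) : ℤ)) = t ^ 2 + 4 * m := by
    intro ab hab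
    obtain ⟨hab0, hfa⟩ := mem_filter.1 hab
    obtain ⟨ha', -, hb, hdvd, -, -⟩ := hs ab hab0
    subst hfa
    obtain ⟨c, hc⟩ := hdvd
    have hc4 : (D - ab.2 ^ 2) / (4 * ab.1) = c := by rw [hc, Nat.mul_div_cancel_left c (by omega)]
    have hE : D = ab.2 ^ 2 + 4 * ab.1 * c := by omega
    rw [hc4, ← hDK, ← hDZ, hE]
    push_cast
    ring
  -- the map into the ideals of norm `a`
  let F : (s.filter fun ab => ab.1 = a) → {I : Ideal (𝓞 K) // Ideal.absNorm I = a} := fun ab =>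
    ⟨Ideal.span {(a : 𝓞 K), bs 1 - ((((ab : ℕ × ℕ).2 + t) / 2 : ℤ) : 𝓞 K)}, by
      have hd := hdisc ab.1 ab.2
      have h2k := two_mul_ediv_two_of_disc_eq hd
      have hn := norm_eq_of_disc_eq hd h2k
      have h := absNorm_span_pair_eq bs hbs hω hn
      rw [Int.natAbs_natCast] at h
      exact_mod_cast h⟩
  have hF : Function.Injective F := by
    rintro ⟨ab, hab⟩ ⟨ab', hab'⟩ he
    have hI : (F ⟨ab, hab⟩ : Ideal (𝓞 K)) = (F ⟨ab', hab'⟩ : Ideal (𝓞 K)) := congrArg Subtype.val he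
    simp only [F] at hI
    set k : ℤ := ((ab.2 : ℤ) + t) / 2 with hk
    set k' : ℤ := ((ab'.2 : ℤ) + t) / 2 with hk'
    have hd := hdisc ab hab
    have h2k : 2 * k = ab.2 + t := two_mul_ediv_two_of_disc_eq hd
    have hn := norm_eq_of_disc_eq hd h2k
    have h2k' : 2 * k' = ab'.2 + t := two_mul_ediv_two_of_disc_eq (hdisc ab' hab')
    -- `k' − k ∈ (a, ω − k)`, hence `a ∣ k' − k`
    have hmem : ((k' - k : ℤ) : 𝓞 K) ∈ Ideal.span {((a : ℤ) : 𝓞 K), bs 1 - (k : 𝓞 K)} := by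
      have h1 : bs 1 - (k' : 𝓞 K) ∈ Ideal.span {((a : ℤ) : 𝓞 K), bs 1 - (k : 𝓞 K)} := by
        rw [Int.cast_natCast, hI]; exact Ideal.subset_span (by simp)
      have h2 : bs 1 - (k : 𝓞 K) ∈ Ideal.span {((a : ℤ) : 𝓞 K), bs 1 - (k : 𝓞 K)} :=
        Ideal.subset_span (by simp)
      have := Ideal.sub_mem _ h2 h1
      rwa [show bs 1 - (k : 𝓞 K) - (bs 1 - (k' : 𝓞 K)) = ((k' - k : ℤ) : 𝓞 K) by push_cast; ring] at this
    have hdvd : (a : ℤ) ∣ k' - k := (intCast_mem_span_pair_iff bs hbs hω hn (k' - k)).1 hmem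
    have hdvd2 : (2 * a : ℤ) ∣ (ab'.2 : ℤ) - ab.2 := by
      obtain ⟨q, hq⟩ := hdvd
      exact ⟨q, by linear_combination h2k - h2k' + 2 * hq⟩
    -- `|b' − b| < 2a`
    obtain ⟨hab0, hfa⟩ := mem_filter.1 hab
    obtain ⟨hab0', hfa'⟩ := mem_filter.1 hab'
    obtain ⟨-, -, hb, -, hlt, -⟩ := hs ab hab0
    obtain ⟨-, -, hb', -, hlt', -⟩ := hs ab' hab0'
    rw [hfa] at hlt
    rw [hfa'] at hlt'
    have h1 : ab'.2 < 2 * a + ab.2 := by nlinarith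
    have h1' : ab.2 < 2 * a + ab'.2 := by nlinarith
    have hzero : (ab'.2 : ℤ) - ab.2 = 0 := by
      refine Int.eq_zero_of_dvd_of_natAbs_lt_natAbs hdvd2 ?_
      zify
      rw [abs_of_pos (by positivity : (0 : ℤ) < 2 * a)]
      rw [abs_sub_lt_iff]
      constructor <;> linarith
    have hb2 : ab.2 = ab'.2 := by omega
    exact Subtype.ext (Prod.ext (hfa.trans hfa'.symm) hb2)
  have h := Nat.card_le_card_of_injective F hF
  rwa [Nat.card_eq_fintype_card, Fintype.card_coe] at h

/-- Hence **at most `τ(a)` reduced pairs of `d_K` have first entry `a`** (`K` real quadratic, `a ≥ 1`).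
[cite: DavenportMNT1980, Ch. 6] -/
theorem card_filter_fst_eq_le_card_divisors (h2 : finrank ℚ K = 2) (hpos : 0 < NumberField.discr K) {a : ℕ}
    (ha : 0 < a) (s : Finset (ℕ × ℕ))
    (hs : ∀ ab ∈ s, 0 < ab.1 ∧ 0 < ab.2 ∧ ab.2 ^ 2 < (NumberField.discr K).toNat ∧
      4 * ab.1 ∣ (NumberField.discr K).toNat - ab.2 ^ 2 ∧ (NumberField.discr K).toNat < (2 * ab.1 + ab.2) ^ 2 ∧
      (2 * ab.1 ≤ ab.2 ∨ (2 * ab.1 - ab.2) ^ 2 < (NumberField.discr K).toNat)) :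
    (s.filter fun ab => ab.1 = a).card ≤ a.divisors.card :=
  (card_filter_fst_eq_le_card_ideals h2 hpos ha s hs).trans
    (Hallgren2005.card_ideals_absNorm_eq_le_card_divisors h2 ha.ne')

/-! ### Pairs lost to a divisor threshold -/

/-- **Threshold on the first entry**: `K' · #{(a, b) ∈ s : τ(a) > K'} ≤ ∑_{(a,b) ∈ s} τ(a) ≤ ∑_{a ≤ ⌊√D⌋} τ(a)²`
for a set `s` of reduced pairs of `d_K` (fibre over `a` has at most `τ(a)` elements). [cite: DavenportMNT1980, Ch. 6] -/
theorem threshold_fst_mul_card_le (h2 : finrank ℚ K = 2) (hpos : 0 < NumberField.discr K) (K' : ℕ)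
    (s : Finset (ℕ × ℕ))
    (hs : ∀ ab ∈ s, 0 < ab.1 ∧ 0 < ab.2 ∧ ab.2 ^ 2 < (NumberField.discr K).toNat ∧
      4 * ab.1 ∣ (NumberField.discr K).toNat - ab.2 ^ 2 ∧ (NumberField.discr K).toNat < (2 * ab.1 + ab.2) ^ 2 ∧
      (2 * ab.1 ≤ ab.2 ∨ (2 * ab.1 - ab.2) ^ 2 < (NumberField.discr K).toNat)) :
    K' * (s.filter fun ab => K' < ab.1.divisors.card).card ≤
      ∑ a ∈ Icc 1 (Nat.sqrt (NumberField.discr K).toNat), a.divisors.card ^ 2 := by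
  classical
  set D : ℕ := (NumberField.discr K).toNat with hD
  have hmaps : ∀ ab ∈ s, ab.1 ∈ Icc 1 (Nat.sqrt D) := fun ab hab =>
    fst_mem_Icc (hs ab hab).1 (hs ab hab).2.2.1 (hs ab hab).2.2.2.2.2
  calc K' * (s.filter fun ab => K' < ab.1.divisors.card).card
        = ∑ ab ∈ s.filter (fun ab => K' < ab.1.divisors.card), K' := by
          rw [sum_const, smul_eq_mul, mul_comm]
    _ ≤ ∑ ab ∈ s.filter (fun ab => K' < ab.1.divisors.card), ab.1.divisors.card :=
          sum_le_sum fun ab hab => (mem_filter.1 hab).2.le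
    _ ≤ ∑ ab ∈ s, ab.1.divisors.card :=
          sum_le_sum_of_subset_of_nonneg (filter_subset _ _) fun _ _ _ => Nat.zero_le _
    _ = ∑ a ∈ Icc 1 (Nat.sqrt D), ∑ ab ∈ s.filter (fun ab => ab.1 = a), ab.1.divisors.card :=
          (sum_fiberwise_of_maps_to hmaps _).symm
    _ = ∑ a ∈ Icc 1 (Nat.sqrt D), a.divisors.card * (s.filter fun ab => ab.1 = a).card := by
          refine sum_congr rfl fun a _ => ?_
          rw [sum_congr rfl fun ab hab => by rw [(mem_filter.1 hab).2], sum_const, smul_eq_mul, mul_comm]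
    _ ≤ ∑ a ∈ Icc 1 (Nat.sqrt D), a.divisors.card * a.divisors.card :=
          sum_le_sum fun a ha => Nat.mul_le_mul_left _
            (card_filter_fst_eq_le_card_divisors h2 hpos (mem_Icc.1 ha).1 s hs)
    _ = ∑ a ∈ Icc 1 (Nat.sqrt D), a.divisors.card ^ 2 := sum_congr rfl fun a _ => (sq _).symm

/-- **The reduced pairs lost to a divisor threshold.** For a set `s` of reduced pairs of `d_K` (`K` real
quadratic) and a threshold `K'`: `K' · #{(a, b) ∈ s : τ((D − b²)/4) > K'²} ≤ 2 ∑_{a ≤ ⌊√D⌋} τ(a)²` — since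
`(D − b²)/4 = ac` and `τ(ac) ≤ τ(a)τ(c)`, a lost pair has `τ(a) > K'` or `τ(c) > K'`, and `(a, b) ↦ (c, b)` is an
injection into reduced pairs (`partner`), so both kinds are counted by `threshold_fst_mul_card_le`. [folklore] -/
theorem threshold_mul_card_le (h2 : finrank ℚ K = 2) (hpos : 0 < NumberField.discr K) (K' : ℕ)
    (s : Finset (ℕ × ℕ))
    (hs : ∀ ab ∈ s, 0 < ab.1 ∧ 0 < ab.2 ∧ ab.2 ^ 2 < (NumberField.discr K).toNat ∧
      4 * ab.1 ∣ (NumberField.discr K).toNat - ab.2 ^ 2 ∧ (NumberField.discr K).toNat < (2 * ab.1 + ab.2) ^ 2 ∧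
      (2 * ab.1 ≤ ab.2 ∨ (2 * ab.1 - ab.2) ^ 2 < (NumberField.discr K).toNat)) :
    K' * (s.filter fun ab =>
        K' ^ 2 < (((NumberField.discr K).toNat - ab.2 ^ 2) / 4).divisors.card).card ≤
      2 * ∑ a ∈ Icc 1 (Nat.sqrt (NumberField.discr K).toNat), a.divisors.card ^ 2 := by
  classical
  set D : ℕ := (NumberField.discr K).toNat with hD
  -- the involution
  set ι : ℕ × ℕ → ℕ × ℕ := fun ab => ((D - ab.2 ^ 2) / (4 * ab.1), ab.2) with hι
  have hιred : ∀ ab ∈ s, (0 < (ι ab).1 ∧ 0 < (ι ab).2 ∧ (ι ab).2 ^ 2 < D ∧ 4 * (ι ab).1 ∣ D - (ι ab).2 ^ 2 ∧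
      D < (2 * (ι ab).1 + (ι ab).2) ^ 2 ∧ (2 * (ι ab).1 ≤ (ι ab).2 ∨ (2 * (ι ab).1 - (ι ab).2) ^ 2 < D)) ∧
      ι (ι ab) = ab := by
    intro ab hab
    obtain ⟨ha, hb0, hb, hdvd, hlt, hred⟩ := hs ab hab
    obtain ⟨h1, h2'⟩ := partner ha hb0 hb hdvd hlt hred
    exact ⟨h1, Prod.ext h2' rfl⟩
  have hinj : Set.InjOn ι s := by
    intro ab hab ab' hab' he
    rw [← (hιred ab hab).2, ← (hιred ab' hab').2, he]
  set badA := s.filter fun ab => K' < ab.1.divisors.card with hbadA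
  set badC := s.filter fun ab => K' < (ι ab).1.divisors.card with hbadC
  have hA : K' * badA.card ≤ ∑ a ∈ Icc 1 (Nat.sqrt D), a.divisors.card ^ 2 :=
    threshold_fst_mul_card_le h2 hpos K' s hs
  -- the pairs with `τ(c) > K'`, transported by the involution
  set t := badC.image ι with ht
  have htred : ∀ ab ∈ t, 0 < ab.1 ∧ 0 < ab.2 ∧ ab.2 ^ 2 < D ∧ 4 * ab.1 ∣ D - ab.2 ^ 2 ∧
      D < (2 * ab.1 + ab.2) ^ 2 ∧ (2 * ab.1 ≤ ab.2 ∨ (2 * ab.1 - ab.2) ^ 2 < D) := by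
    intro ab hab
    obtain ⟨ab', hab', rfl⟩ := mem_image.1 hab
    exact (hιred ab' (mem_filter.1 hab').1).1
  have hcard : t.card = badC.card := card_image_of_injOn (hinj.mono (coe_subset.2 (filter_subset _ _)))
  have hfilter : (t.filter fun ab => K' < ab.1.divisors.card) = t := by
    refine filter_true_of_mem fun ab hab => ?_
    obtain ⟨ab', hab', rfl⟩ := mem_image.1 hab
    exact (mem_filter.1 hab').2
  have hC : K' * badC.card ≤ ∑ a ∈ Icc 1 (Nat.sqrt D), a.divisors.card ^ 2 := by
    have h := threshold_fst_mul_card_le h2 hpos K' t htred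
    rwa [hfilter, hcard] at h
  -- a lost pair has `τ(a) > K'` or `τ(c) > K'` (the lost set is read off the goal, not restated)
  refine le_trans (Nat.mul_le_mul_left K'
    (le_trans (card_le_card fun ab hab => ?_) (card_union_le badA badC))) ?_
  · obtain ⟨hab, hlt⟩ := mem_filter.1 hab
    rw [mem_union, hbadA, hbadC, mem_filter, mem_filter]
    obtain ⟨ha, -, -, hdvd, -, -⟩ := hs ab hab
    rw [quarter_eq_mul ha hdvd] at hlt
    by_contra h
    rw [not_or, not_and, not_lt, not_and, not_lt] at h
    have h1 : ab.1.divisors.card ≤ K' := h.1 hab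
    have h2 : ((D - ab.2 ^ 2) / (4 * ab.1)).divisors.card ≤ K' := h.2 hab
    -- `τ(ac) ≤ τ(a) τ(c)` (`divisors (ac) = divisors a · divisors c` pointwise)
    have h3 : (ab.1 * ((D - ab.2 ^ 2) / (4 * ab.1))).divisors.card ≤
        ab.1.divisors.card * ((D - ab.2 ^ 2) / (4 * ab.1)).divisors.card := by
      rw [Nat.divisors_mul]
      exact Finset.card_mul_le
    have h4 := Nat.mul_le_mul h1 h2
    rw [sq] at hlt
    exact absurd (hlt.trans_le (h3.trans h4)) (lt_irrefl _)
  · rw [mul_add, two_mul]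
    exact add_le_add hA hC

/-- **The reduced pairs lost to a divisor threshold, in closed form**: with `∑_{a ≤ A} τ(a)² ≤ A (1 + log A)³`
(`Hallgren2005.sum_card_divisors_sq_le`), `K' · #{(a, b) ∈ s : τ((D − b²)/4) > K'²} ≤ 2 √D (1 + log D)³`.
[folklore] -/
theorem threshold_mul_card_le_sqrt_mul_log (h2 : finrank ℚ K = 2) (hpos : 0 < NumberField.discr K) (K' : ℕ)
    (s : Finset (ℕ × ℕ))
    (hs : ∀ ab ∈ s, 0 < ab.1 ∧ 0 < ab.2 ∧ ab.2 ^ 2 < (NumberField.discr K).toNat ∧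
      4 * ab.1 ∣ (NumberField.discr K).toNat - ab.2 ^ 2 ∧ (NumberField.discr K).toNat < (2 * ab.1 + ab.2) ^ 2 ∧
      (2 * ab.1 ≤ ab.2 ∨ (2 * ab.1 - ab.2) ^ 2 < (NumberField.discr K).toNat)) :
    ((K' * (s.filter fun ab =>
        K' ^ 2 < (((NumberField.discr K).toNat - ab.2 ^ 2) / 4).divisors.card).card : ℕ) : ℝ) ≤
      2 * (Real.sqrt (NumberField.discr K).toNat * (1 + Real.log (NumberField.discr K).toNat) ^ 3) := by
  set D : ℕ := (NumberField.discr K).toNat with hD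
  have h := threshold_mul_card_le h2 hpos K' s hs
  have hsum := Hallgren2005.sum_card_divisors_sq_le (Nat.sqrt D)
  have hA : (Nat.sqrt D : ℝ) ≤ Real.sqrt D := Real.nat_sqrt_le_real_sqrt
  have hlog0 : 0 ≤ Real.log (Nat.sqrt D : ℕ) := Real.log_natCast_nonneg _
  have hlogA : Real.log (Nat.sqrt D : ℕ) ≤ Real.log D := by
    rcases Nat.eq_zero_or_pos (Nat.sqrt D) with h0 | h0
    · rw [h0, Nat.cast_zero, Real.log_zero]; exact Real.log_natCast_nonneg _
    · exact Real.log_le_log (by exact_mod_cast h0) (by exact_mod_cast Nat.sqrt_le_self D)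
  have h1 : 0 ≤ 1 + Real.log (Nat.sqrt D : ℕ) := by linarith
  -- (the lost set is read off the goal, not restated)
  refine (Nat.cast_le.2 h).trans ?_
  rw [Nat.cast_mul, Nat.cast_ofNat]
  refine mul_le_mul_of_nonneg_left (hsum.trans ?_) (by norm_num)
  exact mul_le_mul hA (pow_le_pow_left₀ h1 (by linarith) 3) (pow_nonneg h1 3) (Real.sqrt_nonneg _)

/-! ### The finite set of reduced pairs -/

/-- The reduced pairs of `D` form a finite set (both entries are `< D`). [folklore] -/
theorem exists_finset (D : ℕ) : ∃ s : Finset (ℕ × ℕ), ∀ ab : ℕ × ℕ, ab ∈ s ↔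
    (0 < ab.1 ∧ 0 < ab.2 ∧ ab.2 ^ 2 < D ∧ 4 * ab.1 ∣ D - ab.2 ^ 2 ∧ D < (2 * ab.1 + ab.2) ^ 2 ∧
      (2 * ab.1 ≤ ab.2 ∨ (2 * ab.1 - ab.2) ^ 2 < D)) := by
  classical
  refine ⟨(range D ×ˢ range D).filter fun ab => 0 < ab.1 ∧ 0 < ab.2 ∧ ab.2 ^ 2 < D ∧ 4 * ab.1 ∣ D - ab.2 ^ 2 ∧
      D < (2 * ab.1 + ab.2) ^ 2 ∧ (2 * ab.1 ≤ ab.2 ∨ (2 * ab.1 - ab.2) ^ 2 < D), fun ab => ?_⟩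
  rw [mem_filter, mem_product, mem_range, mem_range]
  refine ⟨And.right, fun h => ⟨⟨?_, ?_⟩, h⟩⟩
  · have := fst_mul_self_lt h.2.2.1 h.2.2.2.2.2
    nlinarith [h.1]
  · nlinarith [h.2.1, h.2.2.1]

end RealReducedPairs

end Literature.Computability.Cryptography

end
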